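import Summits.HodgeConjecture.HodgeConjecture.Theorems.F0P3bSymPowerDerivation
import Mathlib.Analysis.SpecialFunctions.Exponential
import Mathlib.Analysis.Normed.Algebra.MatrixExponential
import Mathlib.Analysis.Matrix.Normed
import Mathlib.Analysis.Complex.RealDeriv
import Mathlib.Analysis.Calculus.Deriv.Pi
import Mathlib.Analysis.Calculus.Deriv.Prod
import Mathlib.Analysis.Calculus.Deriv.Mul
import Mathlib.Analysis.Calculus.Deriv.Pow
import Mathlib.Analysis.Calculus.Deriv.Add
import Mathlib.Topology.Algebra.MvPolynomial
import HarnessLib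

/-!
# FLOOR-0 P3b «ENGINE local packets T3 ∕ T4», line `F0_LocalAPackets` — brief β1: the CALCULUS of `Sym^m`
# (`d/dt|₀ Sym^m(exp tX) = dSym^m(X)`, the derivation matrix in the monomial basis)

Cell hodgecm-mathlib (D-0151), FLOOR 0, crux item H413 = stmt-HodgeConjecture-24833; sub-line
`Cruxes/H413/Lines/F0_LocalAPackets.lean` (F0P3b-plan, ed. 1.1), waypoint W1 of the load-bearing stub T3a₁
`StubT3aRealisationDatum` («`K`-INTEGRATION of Kovačević's `ladderPlus`: each `K`-type is `Sym^{n−1}(ℂ²) ⊠ (u ↦ u^{1−n})` via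
★ `symPowerMat`; the axiom `IsGKModule.hasWeakDeriv` needs `d/dt Sym^{n−1}(exp tX)|₀ = dSym^{n−1}(X)` — one lemma, not in the tree by
name», card §W1).  Brief β1 of F0P3b-plan (g5), 2026-08-31T01:25:35Z (3).  Author A-p18 (g17).  Helper file (`--supports
stmt-HodgeConjecture-24833 --as helper`); PROOF lane (theorems only; no `def`, no `sorry`, no instance, no notation, no named fact);
imports the companion DEF leaf ★ `Theorems/F0P3bSymPowerDerivation` (`dSymPowerMat`, item (a)) + Mathlib calculus ∕ matrix-norm modules only
(nothing on the R2 reverse cone).  Kovačević-FREE.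

## What is here
* (§1 = the companion leaf `F0P3bSymPowerDerivation`: `dSymPowerMat m X`, the explicit tridiagonal derivation matrix, linear in `X`.)
* §2 (`ℂ`) `continuous_symPowerMat` — entries are the universal polynomials of ★ `eval_symPowerMat_mvPolynomialX`, hence continuous and
  `ℂ`-differentiable (`differentiable_eval_mvPolynomial`).
* §3 (`ℂ`) chain rule through the polynomial entries (`hasDerivAt_symPowerMat_apply_of_curve`); along the four AFFINE basis curves
  `1 + tE_{ab}` the ★ closed forms `symPowerMat_upper ∕ _lower ∕ _diagonal` give the derivative outright (only the exponent-one binomial terms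
  survive: `C(j,j−1) = j`, `C(m−j,1) = m−j`), so the `ℂ`-differential of each entry at `1` IS `dSym^m` (`fderiv_entry_eq_dSymPowerMat`,
  uniqueness of derivatives + linearity).
* §4 (`ℂ`) **`hasDerivAt_symPowerMat_exp_apply (m X i j) : HasDerivAt (fun t : ℝ => symPowerMat m (NormedSpace.exp (t • X)) i j)
  (dSymPowerMat m X i j) 0`** — ENTRYWISE, norm-free statement (the shape `IsGKModule.hasWeakDeriv` consumes through
  `ℓ (ρK (expK (t • X)) v)`, real `t • X` as in ★ `RealMatrixGroup.expK`; the proof runs under `open scoped Matrix.Norms.Operator`, the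
  `L^∞`-operator norm preamble of ★ `CompactGroups/MatrixGroupExpSurjective`), plus the `(t : ℂ) • X` variant.
Not here (not needed by `hasWeakDeriv`; both follow from §4 + ★ `symPowerMat_mul`): `Sym^m(exp tX) = exp(t·dSym^m X)` and the
Lie-homomorphism property of `dSym^m`.

HONEST LABEL: HC_CM is proved only modulo the printed citations until rung 0 closes; this file is generic calculus of the algebraic
representation `Sym^m : GL₂ → GL_{m+1}` and discharges nothing printed.

References: [BorelWallach2000] 0 §2.5 (the `(𝔤,K)`-module axiom `(d/dt)|₀ π(exp tX) v = π(X) v`); [Kovacevic2021] §3 (the `K`-types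
`V_{n,m}` as symmetric powers).
-/

set_option autoImplicit false
set_option linter.dupNamespace false

noncomputable section

open MvPolynomial Literature.RepresentationTheory.AlgebraicGroups.SL2Sym

namespace Summit.HodgeConjecture.HodgeConjecture.Cruxes.H413.F0P3bSymPowerCalculus

open Summit.HodgeConjecture.HodgeConjecture.Cruxes.H413.F0P3bSymPowerDerivation

/-! ## §2 Polynomial entries: continuity and differentiability of `Sym^m` over `ℂ` -/

section Analysis

open scoped Matrix.Norms.Operator

/-- **Evaluation of a complex polynomial in finitely many variables is `ℂ`-differentiable** (induction on the polynomial;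
Mathlib has the single-variable `Polynomial.differentiable_aeval`). [folklore] -/
theorem differentiable_eval_mvPolynomial {σ : Type*} [Fintype σ] (p : MvPolynomial σ ℂ) :
    Differentiable ℂ fun u : σ → ℂ => MvPolynomial.eval u p := by
  induction p using MvPolynomial.induction_on with
  | C a => simp only [MvPolynomial.eval_C]; exact differentiable_const a
  | add p q hp hq => simp only [map_add]; exact hp.add hq
  | mul_X p i hp => simp only [map_mul, MvPolynomial.eval_X]; exact hp.mul (differentiable_apply i)

/-- **The entries of `Sym^m(g)` are the universal polynomials evaluated at `g`** (★ `eval_symPowerMat_mvPolynomialX`, read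
right to left). [folklore] -/
theorem symPowerMat_apply_eq_eval (m : ℕ) (g : Matrix (Fin 2) (Fin 2) ℂ) (i j : Fin (m + 1)) :
    symPowerMat m g i j = MvPolynomial.eval (fun ab : Fin 2 × Fin 2 => g ab.1 ab.2)
      (symPowerMat m (Matrix.mvPolynomialX (Fin 2) (Fin 2) ℂ) i j) :=
  (eval_symPowerMat_mvPolynomialX m g i j).symm

/-- **(b) `g ↦ Sym^m(g)` is continuous** on `Mat₂(ℂ)` (polynomial entries). [folklore] -/
theorem continuous_symPowerMat (m : ℕ) :
    Continuous (symPowerMat m : Matrix (Fin 2) (Fin 2) ℂ → Matrix (Fin (m + 1)) (Fin (m + 1)) ℂ) := by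
  refine continuous_matrix fun i j => ?_
  have hfun : (fun g : Matrix (Fin 2) (Fin 2) ℂ => symPowerMat m g i j) =
      (fun u : Fin 2 × Fin 2 → ℂ => MvPolynomial.eval u (symPowerMat m (Matrix.mvPolynomialX (Fin 2) (Fin 2) ℂ) i j)) ∘
        fun g : Matrix (Fin 2) (Fin 2) ℂ => fun ab : Fin 2 × Fin 2 => g ab.1 ab.2 := by
    funext g
    exact symPowerMat_apply_eq_eval m g i j
  rw [hfun]
  exact (MvPolynomial.continuous_eval _).comp
    (continuous_pi fun ab => (continuous_apply ab.2).comp (continuous_apply ab.1))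

/-! ## §3 The chain rule through the polynomial entries and the four affine basis curves -/

/-- **Chain rule**: for a curve `γ` through `1` with entrywise derivatives `γ′(0)`, `Sym^m(γ(t))_{ij}` has derivative `L(γ′(0))` at
`0`, `L` any `ℂ`-differential at the identity of the universal entry polynomial `P_{ij}`. [folklore] -/
theorem hasDerivAt_symPowerMat_apply_of_curve (m : ℕ) (i j : Fin (m + 1))
    {L : (Fin 2 × Fin 2 → ℂ) →L[ℂ] ℂ}
    (hL : HasFDerivAt
      (fun u : Fin 2 × Fin 2 → ℂ => MvPolynomial.eval u (symPowerMat m (Matrix.mvPolynomialX (Fin 2) (Fin 2) ℂ) i j))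
      L (fun ab : Fin 2 × Fin 2 => (1 : Matrix (Fin 2) (Fin 2) ℂ) ab.1 ab.2))
    {γ : ℝ → Matrix (Fin 2) (Fin 2) ℂ} {γ' : Matrix (Fin 2) (Fin 2) ℂ} (hγ0 : γ 0 = 1)
    (hγ : ∀ a b : Fin 2, HasDerivAt (fun t => γ t a b) (γ' a b) 0) :
    HasDerivAt (fun t => symPowerMat m (γ t) i j) (L fun ab => γ' ab.1 ab.2) 0 := by
  have hu : HasDerivAt (fun t : ℝ => fun ab : Fin 2 × Fin 2 => γ t ab.1 ab.2)
      (fun ab : Fin 2 × Fin 2 => γ' ab.1 ab.2) 0 :=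
    hasDerivAt_pi.2 fun ab => hγ ab.1 ab.2
  have hL' : HasFDerivAt
      (fun u : Fin 2 × Fin 2 → ℂ => MvPolynomial.eval u (symPowerMat m (Matrix.mvPolynomialX (Fin 2) (Fin 2) ℂ) i j))
      (L.restrictScalars ℝ) (fun ab : Fin 2 × Fin 2 => γ 0 ab.1 ab.2) := by
    rw [hγ0]
    exact hL.restrictScalars ℝ
  have h := hL'.comp_hasDerivAt (0 : ℝ) hu
  have hfun : (fun t => symPowerMat m (γ t) i j) =
      (fun u : Fin 2 × Fin 2 → ℂ => MvPolynomial.eval u (symPowerMat m (Matrix.mvPolynomialX (Fin 2) (Fin 2) ℂ) i j)) ∘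
        fun t : ℝ => fun ab : Fin 2 × Fin 2 => γ t ab.1 ab.2 := by
    funext t
    exact symPowerMat_apply_eq_eval m (γ t) i j
  rw [hfun]
  exact h

/-- Entries of the affine curve `t ↦ 1 + tE` have derivative `E_{ab}` at `t = 0`. [folklore] -/
theorem hasDerivAt_one_add_smul_apply (E : Matrix (Fin 2) (Fin 2) ℂ) (a b : Fin 2) :
    HasDerivAt (fun t : ℝ => ((1 : Matrix (Fin 2) (Fin 2) ℂ) + (t : ℂ) • E) a b) (E a b) 0 := by
  have hid : HasDerivAt (fun t : ℝ => (t : ℂ)) 1 0 := by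
    simpa using (hasDerivAt_id ((0 : ℝ) : ℂ)).comp_ofReal
  have h := (hid.mul_const (E a b)).const_add ((1 : Matrix (Fin 2) (Fin 2) ℂ) a b)
  simp only [one_mul] at h
  refine h.congr_of_eventuallyEq (Filter.Eventually.of_forall fun t => ?_)
  simp only [Matrix.add_apply, Matrix.smul_apply, smul_eq_mul]

/-- The affine curve through `1` in the direction `E`, read through `Sym^m`: derivative `L(E)` at `0`. [folklore] -/
theorem hasDerivAt_symPowerMat_one_add_smul_apply (m : ℕ) (i j : Fin (m + 1))
    {L : (Fin 2 × Fin 2 → ℂ) →L[ℂ] ℂ}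
    (hL : HasFDerivAt
      (fun u : Fin 2 × Fin 2 → ℂ => MvPolynomial.eval u (symPowerMat m (Matrix.mvPolynomialX (Fin 2) (Fin 2) ℂ) i j))
      L (fun ab : Fin 2 × Fin 2 => (1 : Matrix (Fin 2) (Fin 2) ℂ) ab.1 ab.2))
    (E : Matrix (Fin 2) (Fin 2) ℂ) :
    HasDerivAt (fun t : ℝ => symPowerMat m ((1 : Matrix (Fin 2) (Fin 2) ℂ) + (t : ℂ) • E) i j)
      (L fun ab => E ab.1 ab.2) 0 :=
  hasDerivAt_symPowerMat_apply_of_curve m i j hL (γ := fun t : ℝ => (1 : Matrix (Fin 2) (Fin 2) ℂ) + (t : ℂ) • E)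
    (γ' := E) (by simp) (hasDerivAt_one_add_smul_apply E)

/-- `1 + c E₀₁ = !![1, c; 0, 1]`. [folklore] -/
theorem one_add_smul_single_zero_one (c : ℂ) :
    (1 : Matrix (Fin 2) (Fin 2) ℂ) + c • Matrix.single 0 1 (1 : ℂ) = !![1, c; 0, 1] := by
  ext a b
  fin_cases a <;> fin_cases b <;> simp

/-- `1 + c E₁₀ = !![1, 0; c, 1]`. [folklore] -/
theorem one_add_smul_single_one_zero (c : ℂ) :
    (1 : Matrix (Fin 2) (Fin 2) ℂ) + c • Matrix.single 1 0 (1 : ℂ) = !![1, 0; c, 1] := by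
  ext a b
  fin_cases a <;> fin_cases b <;> simp

/-- `1 + c E₀₀ = diag(1 + c, 1)`. [folklore] -/
theorem one_add_smul_single_zero_zero (c : ℂ) :
    (1 : Matrix (Fin 2) (Fin 2) ℂ) + c • Matrix.single 0 0 (1 : ℂ) = Matrix.diagonal ![1 + c, 1] := by
  ext a b
  fin_cases a <;> fin_cases b <;> simp

/-- `1 + c E₁₁ = diag(1, 1 + c)`. [folklore] -/
theorem one_add_smul_single_one_one (c : ℂ) :
    (1 : Matrix (Fin 2) (Fin 2) ℂ) + c • Matrix.single 1 1 (1 : ℂ) = Matrix.diagonal ![1, 1 + c] := by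
  ext a b
  fin_cases a <;> fin_cases b <;> simp

/-- `d/dt|₀ (c · t^n) = c` if `n = 1`, else `0` (real parameter, complex values). [folklore] -/
theorem hasDerivAt_const_mul_ofReal_pow (c : ℂ) (n : ℕ) :
    HasDerivAt (fun t : ℝ => c * (t : ℂ) ^ n) (if n = 1 then c else 0) 0 := by
  have h := ((hasDerivAt_pow n ((0 : ℝ) : ℂ)).const_mul c).comp_ofReal
  refine h.congr_deriv ?_
  rcases Nat.lt_trichotomy n 1 with h0 | h1 | h2
  · have hn : n = 0 := by omega
    subst hn
    simp
  · subst h1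
    simp
  · rw [if_neg (by omega), Complex.ofReal_zero, zero_pow (by omega), mul_zero, mul_zero]

/-- `d/dt|₀ (c · (1 + t)^n) = c · n`. [folklore] -/
theorem hasDerivAt_const_mul_one_add_ofReal_pow (c : ℂ) (n : ℕ) :
    HasDerivAt (fun t : ℝ => c * (1 + (t : ℂ)) ^ n) (c * n) 0 := by
  have h := ((((hasDerivAt_id ((0 : ℝ) : ℂ)).const_add 1).pow n).const_mul c).comp_ofReal
  refine (h.congr_of_eventuallyEq (Filter.Eventually.of_forall fun t => ?_)).congr_deriv ?_
  · simp only [id, Pi.pow_apply]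
  · simp

/-- **Basis curve `E₀₁`**: `d/dt|₀ Sym^m(!![1,t;0,1])_{ij} = dSym^m(E₀₁)_{ij}` — from ★ `symPowerMat_upper` only the term
`C(j, j−1) t` survives differentiation at `0`. [folklore] -/
theorem hasDerivAt_symPowerMat_single_zero_one (m : ℕ) (i j : Fin (m + 1)) :
    HasDerivAt (fun t : ℝ => symPowerMat m ((1 : Matrix (Fin 2) (Fin 2) ℂ) + (t : ℂ) • Matrix.single 0 1 (1 : ℂ)) i j)
      (dSymPowerMat m (Matrix.single 0 1 (1 : ℂ)) i j) 0 := by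
  rw [dSymPowerMat_single_zero_one]
  have hfun : (fun t : ℝ => symPowerMat m ((1 : Matrix (Fin 2) (Fin 2) ℂ) + (t : ℂ) • Matrix.single 0 1 (1 : ℂ)) i j) =
      fun t : ℝ => if (i : ℕ) ≤ j then ((j : ℕ).choose i : ℂ) * (t : ℂ) ^ ((j : ℕ) - i) else 0 := by
    funext t
    rw [one_add_smul_single_zero_one, symPowerMat_upper]
  rw [hfun]
  by_cases hij : (i : ℕ) ≤ j
  · simp only [if_pos hij]
    refine (hasDerivAt_const_mul_ofReal_pow _ _).congr_deriv ?_
    by_cases h1 : (j : ℕ) = i + 1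
    · have hn : (j : ℕ) - i = 1 := by omega
      rw [if_pos hn, if_pos h1, h1, Nat.choose_succ_self_right]
    · have hn : (j : ℕ) - i ≠ 1 := by omega
      rw [if_neg hn, if_neg h1]
  · have h1 : ¬ ((j : ℕ) = i + 1) := by omega
    simp only [if_neg hij, if_neg h1]
    exact hasDerivAt_const 0 (0 : ℂ)

/-- **Basis curve `E₁₀`**: `d/dt|₀ Sym^m(!![1,0;t,1])_{ij} = dSym^m(E₁₀)_{ij}` — from ★ `symPowerMat_lower` only the term
`C(m−j, 1) t` survives. [folklore] -/
theorem hasDerivAt_symPowerMat_single_one_zero (m : ℕ) (i j : Fin (m + 1)) :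
    HasDerivAt (fun t : ℝ => symPowerMat m ((1 : Matrix (Fin 2) (Fin 2) ℂ) + (t : ℂ) • Matrix.single 1 0 (1 : ℂ)) i j)
      (dSymPowerMat m (Matrix.single 1 0 (1 : ℂ)) i j) 0 := by
  rw [dSymPowerMat_single_one_zero]
  have hfun : (fun t : ℝ => symPowerMat m ((1 : Matrix (Fin 2) (Fin 2) ℂ) + (t : ℂ) • Matrix.single 1 0 (1 : ℂ)) i j) =
      fun t : ℝ => if (j : ℕ) ≤ i then ((m - j : ℕ).choose (i - j) : ℂ) * (t : ℂ) ^ ((i : ℕ) - j) else 0 := by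
    funext t
    rw [one_add_smul_single_one_zero, symPowerMat_lower]
  rw [hfun]
  by_cases hji : (j : ℕ) ≤ i
  · simp only [if_pos hji]
    refine (hasDerivAt_const_mul_ofReal_pow _ _).congr_deriv ?_
    by_cases h1 : (i : ℕ) = j + 1
    · have hn : (i : ℕ) - j = 1 := by omega
      have hjm : (j : ℕ) ≤ m := Nat.le_of_lt_succ j.2
      rw [if_pos hn, if_pos h1, hn, Nat.choose_one_right, Nat.cast_sub hjm]
    · have hn : (i : ℕ) - j ≠ 1 := by omega
      rw [if_neg hn, if_neg h1]
  · have h1 : ¬ ((i : ℕ) = j + 1) := by omega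
    simp only [if_neg hji, if_neg h1]
    exact hasDerivAt_const 0 (0 : ℂ)

/-- **Basis curve `E₀₀`**: `d/dt|₀ Sym^m(diag(1+t, 1))_{ij} = (m − j) δ_{ij}` (★ `symPowerMat_diagonal`). [folklore] -/
theorem hasDerivAt_symPowerMat_single_zero_zero (m : ℕ) (i j : Fin (m + 1)) :
    HasDerivAt (fun t : ℝ => symPowerMat m ((1 : Matrix (Fin 2) (Fin 2) ℂ) + (t : ℂ) • Matrix.single 0 0 (1 : ℂ)) i j)
      (dSymPowerMat m (Matrix.single 0 0 (1 : ℂ)) i j) 0 := by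
  rw [dSymPowerMat_single_zero_zero]
  have hfun : (fun t : ℝ => symPowerMat m ((1 : Matrix (Fin 2) (Fin 2) ℂ) + (t : ℂ) • Matrix.single 0 0 (1 : ℂ)) i j) =
      fun t : ℝ => if i = j then (1 : ℂ) * (1 + (t : ℂ)) ^ (m - (j : ℕ)) else 0 := by
    funext t
    rw [one_add_smul_single_zero_zero, symPowerMat_diagonal]
    simp only [one_pow, mul_one, one_mul]
  rw [hfun]
  by_cases hij : i = j
  · simp only [if_pos hij]
    have hjm : (j : ℕ) ≤ m := Nat.le_of_lt_succ j.2
    refine (hasDerivAt_const_mul_one_add_ofReal_pow (1 : ℂ) _).congr_deriv ?_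
    rw [one_mul, Nat.cast_sub hjm]
  · simp only [if_neg hij]
    exact hasDerivAt_const 0 (0 : ℂ)

/-- **Basis curve `E₁₁`**: `d/dt|₀ Sym^m(diag(1, 1+t))_{ij} = j δ_{ij}` (★ `symPowerMat_diagonal`). [folklore] -/
theorem hasDerivAt_symPowerMat_single_one_one (m : ℕ) (i j : Fin (m + 1)) :
    HasDerivAt (fun t : ℝ => symPowerMat m ((1 : Matrix (Fin 2) (Fin 2) ℂ) + (t : ℂ) • Matrix.single 1 1 (1 : ℂ)) i j)
      (dSymPowerMat m (Matrix.single 1 1 (1 : ℂ)) i j) 0 := by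
  rw [dSymPowerMat_single_one_one]
  have hfun : (fun t : ℝ => symPowerMat m ((1 : Matrix (Fin 2) (Fin 2) ℂ) + (t : ℂ) • Matrix.single 1 1 (1 : ℂ)) i j) =
      fun t : ℝ => if i = j then (1 : ℂ) * (1 + (t : ℂ)) ^ (j : ℕ) else 0 := by
    funext t
    rw [one_add_smul_single_one_one, symPowerMat_diagonal]
    simp only [one_pow, one_mul]
  rw [hfun]
  by_cases hij : i = j
  · simp only [if_pos hij]
    refine (hasDerivAt_const_mul_one_add_ofReal_pow (1 : ℂ) _).congr_deriv ?_
    rw [one_mul]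
  · simp only [if_neg hij]
    exact hasDerivAt_const 0 (0 : ℂ)

/-- **The differential of `P_{ij}` at the identity IS `dSym^m(·)_{ij}`**: any `HasFDerivAt` witness `L` agrees with the explicit
derivation matrix on every direction `X` (uniqueness of derivatives on the four matrix units + linearity). [folklore] -/
theorem fderiv_entry_eq_dSymPowerMat (m : ℕ) (i j : Fin (m + 1)) {L : (Fin 2 × Fin 2 → ℂ) →L[ℂ] ℂ}
    (hL : HasFDerivAt
      (fun u : Fin 2 × Fin 2 → ℂ => MvPolynomial.eval u (symPowerMat m (Matrix.mvPolynomialX (Fin 2) (Fin 2) ℂ) i j))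
      L (fun ab : Fin 2 × Fin 2 => (1 : Matrix (Fin 2) (Fin 2) ℂ) ab.1 ab.2))
    (X : Matrix (Fin 2) (Fin 2) ℂ) :
    L (fun ab => X ab.1 ab.2) = dSymPowerMat m X i j := by
  -- on the four matrix units, by uniqueness of the derivative of the affine basis curves
  have hbasis : ∀ a b : Fin 2, L (fun ab => (Matrix.single a b (1 : ℂ)) ab.1 ab.2) =
      dSymPowerMat m (Matrix.single a b (1 : ℂ)) i j := by
    intro a b
    fin_cases a <;> fin_cases b
    · exact (hasDerivAt_symPowerMat_one_add_smul_apply m i j hL _).unique (hasDerivAt_symPowerMat_single_zero_zero m i j)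
    · exact (hasDerivAt_symPowerMat_one_add_smul_apply m i j hL _).unique (hasDerivAt_symPowerMat_single_zero_one m i j)
    · exact (hasDerivAt_symPowerMat_one_add_smul_apply m i j hL _).unique (hasDerivAt_symPowerMat_single_one_zero m i j)
    · exact (hasDerivAt_symPowerMat_one_add_smul_apply m i j hL _).unique (hasDerivAt_symPowerMat_single_one_one m i j)
  -- linearity
  have hX : (fun ab : Fin 2 × Fin 2 => X ab.1 ab.2) =
      ∑ a : Fin 2, ∑ b : Fin 2, X a b • (fun ab : Fin 2 × Fin 2 => (Matrix.single a b (1 : ℂ)) ab.1 ab.2) := by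
    funext ab
    obtain ⟨a', b'⟩ := ab
    simp only [Finset.sum_apply, Matrix.single_apply, Fin.sum_univ_two, Fin.isValue]
    fin_cases a' <;> fin_cases b' <;> simp
  rw [hX, map_sum]
  simp only [map_sum, map_smul, smul_eq_mul, hbasis]
  exact (dSymPowerMat_apply_eq_sum_single m X i j).symm

/-! ## §4 The one-parameter groups `t ↦ Sym^m(exp tX)` -/

/-- Entries of `t ↦ exp(tX)` have derivative `X_{ab}` at `t = 0` (Mathlib `hasDerivAt_exp_smul_const'` under the scoped `L^∞`-operator
norm; the statement itself is norm-free). [folklore] -/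
theorem hasDerivAt_exp_smul_apply (X : Matrix (Fin 2) (Fin 2) ℂ) (a b : Fin 2) :
    HasDerivAt (fun t : ℝ => (NormedSpace.exp (t • X)) a b) (X a b) 0 := by
  have hexp : HasDerivAt (fun t : ℝ => NormedSpace.exp (t • X)) (X * NormedSpace.exp ((0 : ℝ) • X)) 0 :=
    hasDerivAt_exp_smul_const' X 0
  have h := (((LinearMap.toContinuousLinearMap (Matrix.entryLinearMap ℂ ℂ a b)).restrictScalars ℝ).hasFDerivAt).comp_hasDerivAt
    (0 : ℝ) hexp
  refine h.congr_deriv ?_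
  rw [zero_smul, NormedSpace.exp_zero, mul_one]
  rfl

/-- `exp(0 · X) = 1`. [folklore] -/
theorem exp_zero_smul (X : Matrix (Fin 2) (Fin 2) ℂ) : NormedSpace.exp ((0 : ℝ) • X) = 1 := by
  rw [zero_smul, NormedSpace.exp_zero]

/-- **(c) `d/dt|₀ Sym^m(exp tX)_{ij} = dSym^m(X)_{ij}`** — the derivative of the symmetric-power representation along a one-parameter
group is the derivation matrix (ENTRYWISE; real parameter `t • X` as in ★ `RealMatrixGroup.expK`, the shape consumed by
`IsGKModule.hasWeakDeriv`).  Proof: chain rule through the polynomial entries (§3) + `fderiv_entry_eq_dSymPowerMat`. [folklore] -/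
theorem hasDerivAt_symPowerMat_exp_apply (m : ℕ) (X : Matrix (Fin 2) (Fin 2) ℂ) (i j : Fin (m + 1)) :
    HasDerivAt (fun t : ℝ => symPowerMat m (NormedSpace.exp (t • X)) i j) (dSymPowerMat m X i j) 0 := by
  have hL := ((differentiable_eval_mvPolynomial (symPowerMat m (Matrix.mvPolynomialX (Fin 2) (Fin 2) ℂ) i j))
    (fun ab : Fin 2 × Fin 2 => (1 : Matrix (Fin 2) (Fin 2) ℂ) ab.1 ab.2)).hasFDerivAt
  have h := hasDerivAt_symPowerMat_apply_of_curve m i j hL (γ := fun t : ℝ => NormedSpace.exp (t • X)) (γ' := X)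
    (exp_zero_smul X) (hasDerivAt_exp_smul_apply X)
  rwa [fderiv_entry_eq_dSymPowerMat m i j hL X] at h

/-- The same with the complex parameter coerced: `t ↦ Sym^m(exp((t : ℂ) • X))`. [folklore] -/
theorem hasDerivAt_symPowerMat_exp_coe_smul_apply (m : ℕ) (X : Matrix (Fin 2) (Fin 2) ℂ) (i j : Fin (m + 1)) :
    HasDerivAt (fun t : ℝ => symPowerMat m (NormedSpace.exp ((t : ℂ) • X)) i j) (dSymPowerMat m X i j) 0 := by
  refine (hasDerivAt_symPowerMat_exp_apply m X i j).congr_of_eventuallyEq (Filter.Eventually.of_forall fun t => ?_)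
  simp only [Complex.coe_smul]

end Analysis

end Summit.HodgeConjecture.HodgeConjecture.Cruxes.H413.F0P3bSymPowerCalculus

end
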